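/-
Copyright: hsemireg programme, LADDER-HodgeAV H2 lens wave (req-36). Author seat: plan-lens-HodgeAV-anomaly g16 (evidence-only).
-/
import Summits.HodgeConjecture.HodgeConjecture.Cruxes.BlochSeedDiscOne.CoverCountFine
import Summits.HodgeConjecture.HodgeConjecture.Cruxes.BlochSeedDiscOne.CoverCountP

/-!
# CoverCountFineP — the P-side distinct-cell count behind the v2 fine door (shell 3), room hypothesis DISCHARGED

Leaf composing `CoverCount.classB_seven_cells` (anomaly g16) with sheaf8-1's `FineDoorRing2.offaxisP_le_two_fine_ring3`
(v1.6, ae425c20a1f7): behind the fine door every hub-free P-support cell has at most two off-axis letters, so in BRANCH B′(k)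
(`16 ≤ −Re(i^k μ)`, `2Σ − Re(i^k μ) ≤ 0`) at least **7** distinct P-support cells meet the boxes of class `k + 2` — with NO displayed
room hypothesis (modulo `A1e` and the fine shell-3 room premises `OnAlphabet 14 ∧ RingLe 3 ∧ Disj ∧ RuleD ∧ RuleDPFine`).
`fine_ten_P_cells_of_room1` records the sharper count **10** under the (still displayed) sharper room «≤ 1 off-axis letter»
announced at support level by gs-eng-2 g64 (B) (bus l.13708), via `CoverCountP.classB_ten_cells`.

Nothing here is proved toward HC ∕ HC_AV ∕ HC_CM ∕ H2 ∕ 18881; counting facts of the letter model (census-neutral).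
-/

namespace Summit.HodgeConjecture.HodgeConjecture.Cruxes.BlochSeedDiscOne.CoverCountFineP

open Summit.HodgeConjecture.HodgeConjecture.Cruxes.BlochSeedDiscOne.DepthBoundA4
open Summit.HodgeConjecture.HodgeConjecture.Cruxes.BlochSeedDiscOne.BoxIdentity
open Summit.HodgeConjecture.HodgeConjecture.Cruxes.BlochSeedDiscOne.CoverCount
open Summit.HodgeConjecture.HodgeConjecture.Cruxes.BlochSeedDiscOne.LeggedFloor (RuleD Disj)
open Summit.HodgeConjecture.HodgeConjecture.Cruxes.BlochSeedDiscOne.DeepLayerLaws (RingLe)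
open Summit.HodgeConjecture.HodgeConjecture.Cruxes.BlochSeedDiscOne.FineDoorRing2 (RuleDPFine)

/-- Bridge: sheaf8-1's `FineDoorRing2.offCount` is definitionally `CoverCount.offCount`; so behind the fine door a hub-free
P-support cell has `CoverCount.offCount ≤ 2`. -/
theorem offCount_le_two_of_fineP {D : Design} (hD : D.OnAlphabet 14) (hR : RingLe 3 D) (hdisj : Disj D) (hrule : RuleD D)
    (hfine : RuleDPFine D) {y : Cell} (hy : y ∈ D.suppP) (hnh : ∀ f : Fin 4, ¬((y f).x = 0 ∧ (y f).y = 0)) :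
    offCount y ≤ 2 := by
  have h := FineDoorRing2.offaxisP_le_two_fine_ring3 hD hR hdisj hrule hfine hy hnh
  simpa [CoverCount.offCount, CoverCount.nOff, CoverCount.offB, FineDoorRing2.offCount] using h

/-- The N-side bridge restated through sheaf8-1's v1.6 lemma (same content as `CoverCountFine.offCount_le_one_of_fine`). -/
theorem offCount_le_one_of_fineN {D : Design} (hD : D.OnAlphabet 14) (hR : RingLe 3 D) (hdisj : Disj D) (hrule : RuleD D)
    (hfine : RuleDPFine D) {y : Cell} (hy : y ∈ D.suppN) (hnh : ∀ f : Fin 4, ¬((y f).x = 0 ∧ (y f).y = 0)) :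
    offCount y ≤ 1 := by
  have h := FineDoorRing2.offaxisN_le_one_fine_ring3 hD hR hdisj hrule hfine hy hnh
  simpa [CoverCount.offCount, CoverCount.nOff, CoverCount.offB, FineDoorRing2.offCount] using h

/-- **SEVEN DISTINCT P CELLS behind the fine door (no displayed room hypothesis).**  Shell 3, fine room, `A1e`, Branch B′(k)
⇒ `7 ≤ #meetP 14 D (k + 2)`. -/
theorem fine_seven_P_cells {D : Design} (hD : D.OnAlphabet 14) (hR : RingLe 3 D) (hdisj : Disj D) (hrule : RuleD D)
    (hfine : RuleDPFine D) (hA : A1e D) (k : Fin 4)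
    (hk : 16 ≤ -(ipow k * D.mu).re) (hnonpos : 2 * Sigma 14 D - (ipow k * D.mu).re ≤ 0) :
    7 ≤ (meetP 14 D (k + 2)).card :=
  classB_seven_cells 14 D hD hA k hk hnonpos
    (fun _ hc hnh => offCount_le_two_of_fineP hD hR hdisj hrule hfine hc hnh)

/-- **TEN DISTINCT N CELLS behind the fine door**, re-derived through the v1.6 bridge (same statement as `CoverCountFine.fine_ten_cells`). -/
theorem fine_ten_N_cells {D : Design} (hD : D.OnAlphabet 14) (hR : RingLe 3 D) (hdisj : Disj D) (hrule : RuleD D)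
    (hfine : RuleDPFine D) (hA : A1e D) (k : Fin 4) (hpos : 0 < 2 * Sigma 14 D - (ipow k * D.mu).re) :
    10 ≤ (meetN 14 D k).card :=
  classA_ten_cells 14 D hD hA k hpos
    (fun _ hc hnh => offCount_le_one_of_fineN hD hR hdisj hrule hfine hc hnh)

/-- **TEN DISTINCT P CELLS under the sharper P room** «hub-free P-support cells have ≤ 1 off-axis letter» (gs-eng-2 g64 (B):
hub-free P ⊆ `{u⁴, Auuu, Buuu, AAuu, AAAu, AAAA}` at support level — displayed here until packaged as a theorem). -/
theorem fine_ten_P_cells_of_room1 {D : Design} (hD : D.OnAlphabet 14) (hA : A1e D) (k : Fin 4)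
    (hk : 16 ≤ -(ipow k * D.mu).re) (hnonpos : 2 * Sigma 14 D - (ipow k * D.mu).re ≤ 0)
    (hroomP₁ : ∀ c ∈ D.suppP, (∀ f : Fin 4, ¬((c f).x = 0 ∧ (c f).y = 0)) → offCount c ≤ 1) :
    10 ≤ (meetP 14 D (k + 2)).card :=
  CoverCountP.classB_ten_cells 14 D hD hA k hk hnonpos hroomP₁

end Summit.HodgeConjecture.HodgeConjecture.Cruxes.BlochSeedDiscOne.CoverCountFineP
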